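import Mathlib.Algebra.DualNumber
import Mathlib.LinearAlgebra.Matrix.Transvection
import Literature.Computability.AlgebraicComplexity.BI17OddDegreeInvariantsEvenForms
import Literature.Computability.AlgebraicComplexity.BI17Example37Proofs
import Literature.RepresentationTheory.GeneralLinear.OrbitLatticeStability
import Literature.Algebra.Polynomial.JacobianCriterion
import HarnessLib

/-!
# Ternary cubics have no invariants of odd degree; BI 2017 Example 3.7 discharged

Topic `Literature/Computability/AlgebraicComplexity`; theorems only (no definitions, no named
facts). Last file towards the named fact `BI2017_ex_3_7` (P. Bürgisser, C. Ikenmeyer, *Fundamental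
invariants of orbit closures*, J. Algebra 477 (2017), Example 3.7, typed in
`BI17FundamentalInvariantForms.lean`): after `BI17GenericDegreeMonoidSmallCases`,
`BI17InvariantsRectangularHighestWeight`, `BI17Example37Proofs` and
`BI17OddDegreeInvariantsEvenForms` (val-lit-p4 g4) the fact hinged on ONE statement — the ring of
invariants of ternary cubics `ℂ[Sym³ℂ³]^{SL₃}` (Aronhold: `ℂ[S,T]`, `deg S = 4`, `deg T = 6`) has no
odd degrees — which is proved here (`eq_zero_of_mem_slInvariantsOfDegree_three_three_of_odd`), giving
`E(3,3) = 2(ℕ ∖ {1})` (`genericDegreeMonoid_three_three`) and **`BI2017_ex_3_7_holds`**.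

## The argument (elementary; no normal forms, no Hilbert series)

* Involution (in the tree, `aeval_formCoeff_linSubst_eq_zero_of_odd`): an `SL₃`-invariant `F` of odd
  degree vanishes at `g · q` for every `g ∈ SL₃` and every cubic `q` all of whose monomials have even
  degree in `x₀` (the reflection `diag(-1,1,1)` has determinant `-1` and fixes `q`).
* Dominance (this file): the polynomial map
  `(s, t, u, v, q) ↦ u₁₀(s) u₂₀(t) u₀₁(u) u₀₂(v) · (x₀²x₂ + x₁³ + q)`, `u_{ab}(c)` the elementary
  unipotent substitution `x_b ↦ x_b + c x_a` and `q` ranging over the `6`-space `L` of `x₀`-even cubics,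
  has algebraically independent components, so a polynomial vanishing on its image is `0` (§1). We
  index its `10` parameters by the cubic monomials themselves (`DegIdx (Fin 3) 3`: an even monomial
  `x^e` is the coordinate `q_e`, the odd monomials `x₀x₁x₂, x₀x₂², x₀x₁², x₀³` are the parameters
  `s, t, u, v`); then the Jacobian matrix AT THE ORIGIN IS DIAGONAL with entries `1` (even) and
  `2, 2, 3, 1` (odd), because the polarisations `x₁∂₀, x₂∂₀, x₀∂₁, x₀∂₂` of the cuspidal cubic
  `x₀²x₂ + x₁³` are `2x₀x₁x₂, 2x₀x₂², 3x₀x₁², x₀³` (§3) — so the Jacobian determinant is the non-zero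
  polynomial with value `12` at `0`, and the tree's Jacobian criterion (Humphreys § 3.10,
  `algebraicIndependent_iff_det_jacobianMatrix_ne_zero`) applies. (The base cubic being singular is
  irrelevant: only the tangent map of the parametrisation matters.)
* Derivatives through `coeff ∘ linSubst` are computed by forward-mode differentiation in the dual
  numbers `ℂ[ε]` (§2): evaluating at the tangent vector `ε e_p` has `ε`-component `(∂_p ·)(0)`
  (`snd_aeval_dualNumber`), base change commutes with the construction (`map_linSubst`,
  `transvection_map`), and the infinitesimal transvection `x_b ↦ x_b + ε x_a` acts on forms by the
  polarisation operator `x_a ∂_b` (`linSubst_transvection_eps`).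

## Main statements

* `algebraicIndependent_of_det_jacobian_eval_ne_zero` (§1, generic: Jacobian criterion at a point);
  private generic helpers `eq_zero_of_algebraicIndependent_of_forall_aeval_eval_eq_zero` (§1),
  `fst_aeval_dualNumber`, `snd_aeval_dualNumber`, `linSubst_transvection_X`,
  `linSubst_transvection_eps`, `transvection_map`, `snd_coeff_map_add_eps_mul` (§2) — uncited
  folklore, kept private by the Literature citation rule (promote with a locator if needed elsewhere);
* private certificate lemmas `fin_three_degree_three_odd_cases` and the four polarisations of
  `x₀²x₂ + x₁³` (§3);
* `eq_zero_of_mem_slInvariantsOfDegree_three_three_of_odd`,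
  `slInvariantsOfDegree_three_three_eq_bot_of_odd`, `plethysmCoeff_three_three_const_eq_zero_of_odd`
  (`a_{(d,d,d)}(d[3]) = 0` for odd `d`), `genericDegreeMonoid_three_three` (`E(3,3) = 2(ℕ ∖ {1})`),
  `BI2017_ex_3_7_holds` (§4).

HONEST FRAMING (cell `val-lit`, rung V3, row BI17): classical invariant theory (Aronhold, 1850s) as
typed-fact bookkeeping; nothing here bears on permanent versus determinant; VP ≠ VNP is NOT proved
and nothing in this file is progress on it.

## References
* [BurgisserIkenmeyer2017] P. Bürgisser, C. Ikenmeyer, J. Algebra 477 (2017), Ex. 3.7 (main.tex L823).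
* [Humphreys1990] J. E. Humphreys, *Reflection groups and Coxeter groups*, CUP 1990, § 3.10
  (Jacobian criterion).

## Tree
`aeval_formCoeff_linSubst_eq_zero_of_odd` (`BI17OddDegreeInvariantsEvenForms`);
`BI2017_ex_3_7_of_ternaryCubic_odd_vanishing` (`BI17Example37Proofs`);
`genericDegreeMonoid_three_three_of_odd_vanishing`, `finrank_slInvariantsOfDegree_eq_plethysmCoeff`
(`BI17InvariantsRectangularHighestWeight`); `algebraicIndependent_iff_det_jacobianMatrix_ne_zero`,
`jacobianMatrix` (`Literature/Algebra/Polynomial/JacobianCriterion`); `map_linSubst`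
(`RepresentationTheory/GeneralLinear/OrbitLatticeStability`); `linSubst`, `linSubst_X`, `linSubst_C`,
`linSubst_one` (`LinSubst`); `DegIdx`, `degMonomials`, `formCoeff` (`OrbitCoordinateRing`); Mathlib
`DualNumber`, `TrivSqZeroExt`, `Matrix.transvection`, `MvPolynomial.pderiv`, `MvPolynomial.funext`.

Provenance: val-lit cell, prover val-lit-p4 g5 (registry claim #1 on `BI2017_ex_3_7`), successor of
val-lit-p4 g4 whose note `HOME/bip/NOTE-p4g4-E33-odd-vanishing.md` sized this route.
-/

namespace Literature.Computability.AlgebraicComplexity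

open MvPolynomial
open scoped DualNumber
open _root_.Literature.NumberTheory.DiophantineGeometry
open _root_.Literature.RepresentationTheory.GeneralLinear (map_linSubst)
open _root_.Literature.Algebra.Polynomial.JacobianCriterion

/-! ### §1 Dominant polynomial maps kill nothing: two generic lemmas -/

section Generic

/-- If a family `Φ` of polynomials is algebraically independent over `ℂ` and a polynomial `F`
vanishes at every point `Φ(x)` of the image of the polynomial map `x ↦ (Φ_e(x))_e`, then `F = 0`:
`F ∘ Φ` vanishes identically as a function, hence as a polynomial (`ℂ` infinite), and
`F ↦ F ∘ Φ` is injective. [folklore] -/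
private theorem eq_zero_of_algebraicIndependent_of_forall_aeval_eval_eq_zero {ι κ : Type*}
    (Φ : κ → MvPolynomial ι ℂ) (hΦ : AlgebraicIndependent ℂ Φ) (F : MvPolynomial κ ℂ)
    (h : ∀ x : ι → ℂ, aeval (fun e => eval x (Φ e)) F = 0) : F = 0 := by
  haveI : Infinite ℂ := CharZero.infinite ℂ
  refine algebraicIndependent_iff.mp hΦ F (MvPolynomial.funext fun x => ?_)
  rw [map_zero]
  change aeval x (aeval Φ F) = 0
  rw [← AlgHom.comp_apply, comp_aeval]
  exact h x

/-- **Jacobian criterion at a point.** Over a field of characteristic `0`, `n` polynomials in `n`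
variables whose Jacobian matrix evaluated at some point `x₀` is invertible are algebraically
independent (the Jacobian determinant is then a non-zero polynomial; Humphreys § 3.10).
[cite: Humphreys1990, § 3.10 Proposition] -/
theorem algebraicIndependent_of_det_jacobian_eval_ne_zero {K : Type*} [Field K] [CharZero K]
    {ι : Type*} [Fintype ι] [DecidableEq ι] (Φ : ι → MvPolynomial ι K) (x₀ : ι → K)
    (h : (Matrix.of fun e p => eval x₀ (pderiv p (Φ e))).det ≠ 0) : AlgebraicIndependent K Φ := by
  rw [algebraicIndependent_iff_det_jacobianMatrix_ne_zero]
  intro hJ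
  apply h
  have hM : (Matrix.of fun e p => eval x₀ (pderiv p (Φ e))) = (eval x₀).mapMatrix (jacobianMatrix Φ) := by
    ext e p
    simp [jacobianMatrix_apply]
  rw [hM, ← RingHom.map_det, hJ, map_zero]

end Generic

/-! ### §2 Forward-mode differentiation through the dual numbers -/

section Dual

open TrivSqZeroExt

variable {K : Type*} [CommRing K] {ι : Type*}

/-- The first component of an evaluation of a polynomial in the dual numbers `K[ε]` is the
evaluation at the first components. [folklore] -/
private theorem fst_aeval_dualNumber (t : ι → K[ε]) (f : MvPolynomial ι K) :
    fst (aeval t f) = eval (fun i => fst (t i)) f := by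
  have hcomp : (fstHom K K K).comp (aeval t) = aeval (fun i => fst (t i)) := by
    refine MvPolynomial.algHom_ext fun i => ?_
    simp
  exact DFunLike.congr_fun hcomp f

/-- **Forward-mode differentiation.** Evaluating a polynomial `f` at the tangent vector
`x + ε e_p ∈ K[ε]^ι` (first components `x`, second components the `p`-th unit vector) gives
`f(x) + ε (∂f/∂x_p)(x)`: its `ε`-component is the partial derivative at `x`. [folklore] -/
private theorem snd_aeval_dualNumber [DecidableEq ι] (x : ι → K) (p : ι) (t : ι → K[ε])
    (hfst : ∀ i, fst (t i) = x i) (hsnd : ∀ i, snd (t i) = if i = p then 1 else 0)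
    (f : MvPolynomial ι K) : snd (aeval t f) = eval x (pderiv p f) := by
  have hx : (fun i => fst (t i)) = x := funext hfst
  induction f using MvPolynomial.induction_on with
  | C a =>
    rw [pderiv_C, map_zero, MvPolynomial.algHom_C, algebraMap_eq_inl', snd_inl]
  | add f g hf hg => rw [map_add, snd_add, hf, hg, map_add, map_add]
  | mul_X f i hf =>
    rw [map_mul, aeval_X, DualNumber.snd_mul, hf, hsnd, fst_aeval_dualNumber, hx, hfst, pderiv_mul,
      pderiv_X, map_add, map_mul, map_mul, eval_X]
    by_cases hip : i = p
    · subst hip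
      simp
      ring
    · simp [hip]

/-- Base change of a transvection matrix along a ring homomorphism. [folklore] -/
private theorem transvection_map {R S : Type*} [CommRing R] [CommRing S] {n : Type*} [DecidableEq n]
    (f : R →+* S) (i j : n) (c : R) :
    (Matrix.transvection i j c).map f = Matrix.transvection i j (f c) := by
  ext a b
  simp only [Matrix.transvection, Matrix.map_apply, Matrix.add_apply, Matrix.one_apply,
    Matrix.single_apply, map_add]
  split_ifs <;> simp

/-- A transvection `x_b ↦ x_b + c x_a` on variables: `linSubst (transvection a b c)` sends `X i` to
`X i + [i = b] c X a`. [folklore] -/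
private theorem linSubst_transvection_X {R : Type*} [CommRing R] {σ : Type*} [Fintype σ] [DecidableEq σ]
    (a b : σ) (c : R) (i : σ) :
    linSubst σ R (Matrix.transvection a b c) (X i) = X i + (if i = b then c • X a else 0) := by
  rw [linSubst_X]
  simp only [Matrix.transvection, Matrix.add_apply, Matrix.one_apply, Matrix.single_apply, add_smul,
    Finset.sum_add_distrib, ite_smul, one_smul, zero_smul, Finset.sum_ite_eq', Finset.mem_univ,
    if_true]
  congr 1
  by_cases hib : i = b
  · subst hib
    simp
  · simp [hib, show ¬ (b = i) from fun h => hib h.symm]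

/-- **The infinitesimal transvection acts by the polarisation operator `x_a ∂_b`.** Over the dual
numbers, substituting `x_b ↦ x_b + ε x_a` in a polynomial `q` with coefficients in `K` gives
`q + ε · x_a ∂q/∂x_b` (the Lie algebra action of the elementary matrix `E_{ab}` on forms).
[folklore] -/
private theorem linSubst_transvection_eps {σ : Type*} [Fintype σ] [DecidableEq σ] (a b : σ)
    (q : MvPolynomial σ K) :
    linSubst σ K[ε] (Matrix.transvection a b DualNumber.eps) (map (algebraMap K K[ε]) q) =
      map (algebraMap K K[ε]) q +
        C (DualNumber.eps : K[ε]) * map (algebraMap K K[ε]) (X a * pderiv b q) := by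
  have hε : (C (DualNumber.eps : K[ε]) : MvPolynomial σ K[ε]) * C DualNumber.eps = 0 := by
    rw [← map_mul, DualNumber.eps_mul_eps, C_0]
  induction q using MvPolynomial.induction_on with
  | C c =>
    rw [map_C, linSubst_C, pderiv_C, mul_zero, map_zero, mul_zero, add_zero]
  | add f g hf hg =>
    simp only [map_add, hf, hg, mul_add, map_mul]
    ring
  | mul_X f i hf =>
    rw [map_mul, map_X, map_mul, hf, linSubst_transvection_X, pderiv_mul, pderiv_X]
    by_cases hib : i = b
    · subst hib
      simp only [if_true, Pi.single_eq_same, mul_one, map_add, map_mul, map_X, smul_eq_C_mul]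
      linear_combination (X a * X a * map (algebraMap K K[ε]) ((pderiv i) f)) * hε
    · simp only [hib, if_false, add_zero, Pi.single_eq_of_ne hib, mul_zero, map_mul, map_X]
      ring

/-- The `ε`-component of a coefficient of `q + ε · r` (coefficients of `q, r` in `K`) is the
corresponding coefficient of `r`. [folklore] -/
private theorem snd_coeff_map_add_eps_mul {σ : Type*} (q r : MvPolynomial σ K) (m : σ →₀ ℕ) :
    snd (coeff m (map (algebraMap K K[ε]) q + C (DualNumber.eps : K[ε]) * map (algebraMap K K[ε]) r)) =
      coeff m r := by
  rw [coeff_add, coeff_C_mul, coeff_map, coeff_map, snd_add, algebraMap_eq_inl', algebraMap_eq_inl',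
    snd_inl, zero_add, DualNumber.snd_mul, fst_inl, snd_inl, DualNumber.snd_eps]
  simp

end Dual


/-! ### §3 The certificate: odd cubic monomials and the four polarisations of `x₀²x₂ + x₁³` -/

section Certificate

/-- The exponent vectors of degree `3` in three variables with ODD exponent of `x₀` are exactly
`x₀³, x₀x₁², x₀x₁x₂, x₀x₂²`. [folklore] -/
private theorem fin_three_degree_three_odd_cases (e : Fin 3 →₀ ℕ) (he : e.degree = 3) (ho : ¬ Even (e 0)) :
    e = Finsupp.single 0 3 ∨ e = Finsupp.single 0 1 + Finsupp.single 1 2 ∨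
      e = Finsupp.single 0 1 + Finsupp.single 1 1 + Finsupp.single 2 1 ∨
        e = Finsupp.single 0 1 + Finsupp.single 2 2 := by
  rw [Finsupp.degree_eq_sum, Fin.sum_univ_three] at he
  have key : ∀ a b c : ℕ, e 0 = a → e 1 = b → e 2 = c →
      e = Finsupp.single 0 a + Finsupp.single 1 b + Finsupp.single 2 c := by
    intro a b c ha hb hc
    ext i
    fin_cases i <;> simp [ha, hb, hc]
  have h0 : e 0 = 1 ∨ e 0 = 3 := by
    rcases Nat.even_or_odd (e 0) with h | ⟨k, hk⟩
    · exact absurd h ho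
    · omega
  rcases h0 with h0 | h0
  · rcases (show e 1 = 0 ∨ e 1 = 1 ∨ e 1 = 2 by omega) with h1 | h1 | h1
    · refine Or.inr (Or.inr (Or.inr ?_))
      rw [key 1 0 2 h0 h1 (by omega)]
      ext i
      fin_cases i <;> simp
    · exact Or.inr (Or.inr (Or.inl (key 1 1 1 h0 h1 (by omega))))
    · refine Or.inr (Or.inl ?_)
      rw [key 1 2 0 h0 h1 (by omega)]
      ext i
      fin_cases i <;> simp
  · refine Or.inl ?_
    rw [key 3 0 0 h0 (by omega) (by omega)]
    ext i
    fin_cases i <;> simp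

variable {K : Type*} [CommRing K]

/-- Polarisation `x₁ ∂₀` of the cuspidal cubic `x₀²x₂ + x₁³`: `2 x₀x₁x₂`. [folklore] -/
private theorem X_one_mul_pderiv_zero_cusp :
    (X 1 * pderiv 0 (monomial (Finsupp.single 0 2 + Finsupp.single 2 1) 1 +
        monomial (Finsupp.single 1 3) 1) : MvPolynomial (Fin 3) K) =
      monomial (Finsupp.single 0 1 + Finsupp.single 1 1 + Finsupp.single 2 1) 2 := by
  have e3 : Finsupp.single (1 : Fin 3) 1 + (Finsupp.single 0 2 + Finsupp.single 2 1 - Finsupp.single 0 1) =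
      Finsupp.single 0 1 + Finsupp.single 1 1 + Finsupp.single 2 1 := by
    ext i; fin_cases i <;> simp
  rw [X, map_add, pderiv_monomial, pderiv_monomial, mul_add, monomial_mul, monomial_mul, e3]
  simp

/-- Polarisation `x₂ ∂₀` of `x₀²x₂ + x₁³`: `2 x₀x₂²`. [folklore] -/
private theorem X_two_mul_pderiv_zero_cusp :
    (X 2 * pderiv 0 (monomial (Finsupp.single 0 2 + Finsupp.single 2 1) 1 +
        monomial (Finsupp.single 1 3) 1) : MvPolynomial (Fin 3) K) =
      monomial (Finsupp.single 0 1 + Finsupp.single 2 2) 2 := by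
  have e3 : Finsupp.single (2 : Fin 3) 1 + (Finsupp.single 0 2 + Finsupp.single 2 1 - Finsupp.single 0 1) =
      Finsupp.single 0 1 + Finsupp.single 2 2 := by
    ext i; fin_cases i <;> simp
  rw [X, map_add, pderiv_monomial, pderiv_monomial, mul_add, monomial_mul, monomial_mul, e3]
  simp

/-- Polarisation `x₀ ∂₁` of `x₀²x₂ + x₁³`: `3 x₀x₁²`. [folklore] -/
private theorem X_zero_mul_pderiv_one_cusp :
    (X 0 * pderiv 1 (monomial (Finsupp.single 0 2 + Finsupp.single 2 1) 1 +
        monomial (Finsupp.single 1 3) 1) : MvPolynomial (Fin 3) K) =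
      monomial (Finsupp.single 0 1 + Finsupp.single 1 2) 3 := by
  have e3 : Finsupp.single (0 : Fin 3) 1 + (Finsupp.single 1 3 - Finsupp.single 1 1) =
      Finsupp.single 0 1 + Finsupp.single 1 2 := by
    ext i; fin_cases i <;> simp
  rw [X, map_add, pderiv_monomial, pderiv_monomial, mul_add, monomial_mul, monomial_mul, e3]
  simp

/-- Polarisation `x₀ ∂₂` of `x₀²x₂ + x₁³`: `x₀³`. [folklore] -/
private theorem X_zero_mul_pderiv_two_cusp :
    (X 0 * pderiv 2 (monomial (Finsupp.single 0 2 + Finsupp.single 2 1) 1 +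
        monomial (Finsupp.single 1 3) 1) : MvPolynomial (Fin 3) K) =
      monomial (Finsupp.single 0 3) 1 := by
  have e3 : Finsupp.single (0 : Fin 3) 1 + (Finsupp.single 0 2 + Finsupp.single 2 1 - Finsupp.single 2 1) =
      Finsupp.single 0 3 := by
    ext i; fin_cases i <;> simp
  rw [X, map_add, pderiv_monomial, pderiv_monomial, mul_add, monomial_mul, monomial_mul, e3]
  simp

end Certificate


/-! ### §4 Density of `SL₃ · L` and the vanishing of odd-degree invariants of ternary cubics -/

section Main

/-- **Ternary cubics have no `SL₃`-invariants of odd degree** (Aronhold: `ℂ[Sym³ℂ³]^{SL₃} = ℂ[S,T]`,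
`deg S = 4`, `deg T = 6`). Proof: an invariant `F` of odd degree vanishes on `g · q` for all
`g ∈ SL₃` and all cubics `q` even in `x₀` (`aeval_formCoeff_linSubst_eq_zero_of_odd`: the reflection
`diag(-1,1,1)` has determinant `-1` and fixes `q`); and the map
`(s,t,u,v,q) ↦ u₁₀(s)u₂₀(t)u₀₁(u)u₀₂(v) · (x₀²x₂ + x₁³ + q)` (elementary unipotents, `q` in the
`6`-space `L` of `x₀`-even cubics) is dominant: indexing its `10` parameters by the cubic monomials
themselves, its Jacobian matrix at the origin is DIAGONAL with entries `1` (even monomials) and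
`2, 2, 3, 1` (the polarisations `x₁∂₀, x₂∂₀, x₀∂₁, x₀∂₂` of `x₀²x₂ + x₁³` are `2x₀x₁x₂, 2x₀x₂², 3x₀x₁²,
x₀³`), so its components are algebraically independent (Jacobian criterion) and `F = 0`.
[cite: BurgisserIkenmeyer2017, Ex. 3.7] -/
theorem eq_zero_of_mem_slInvariantsOfDegree_three_three_of_odd {d : ℕ} (hd : Odd d)
    {F : MvPolynomial (DegIdx (Fin 3) 3) ℂ} (hF : F ∈ slInvariantsOfDegree (Fin 3) ℂ 3 d) : F = 0 := by
  classical
  -- the four odd cubic monomials as coordinates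
  have hmem : ∀ e : Fin 3 →₀ ℕ, e 0 + e 1 + e 2 = 3 → e ∈ degMonomials (Fin 3) 3 := fun e he =>
    mem_degMonomials_iff.mpr (by rw [Finsupp.degree_eq_sum, Fin.sum_univ_three]; exact he)
  let m300 : DegIdx (Fin 3) 3 := ⟨Finsupp.single 0 3, hmem _ (by simp)⟩
  let m120 : DegIdx (Fin 3) 3 := ⟨Finsupp.single 0 1 + Finsupp.single 1 2, hmem _ (by simp)⟩
  let m111 : DegIdx (Fin 3) 3 :=
    ⟨Finsupp.single 0 1 + Finsupp.single 1 1 + Finsupp.single 2 1, hmem _ (by simp)⟩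
  let m102 : DegIdx (Fin 3) 3 := ⟨Finsupp.single 0 1 + Finsupp.single 2 2, hmem _ (by simp)⟩
  have h300 : m300.1 0 = 3 := by simp [m300]
  have h120 : m120.1 0 = 1 := by simp [m120]
  have h111 : m111.1 0 = 1 := by simp [m111]
  have h102 : m102.1 0 = 1 := by simp [m102]
  have hne_of : ∀ (u v : DegIdx (Fin 3) 3) (i : Fin 3), u.1 i ≠ v.1 i → u ≠ v :=
    fun u v i h huv => h (by rw [huv])
  have ne_120_300 : m120 ≠ m300 := hne_of _ _ 0 (by simp [m120, m300])
  have ne_111_300 : m111 ≠ m300 := hne_of _ _ 0 (by simp [m111, m300])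
  have ne_102_300 : m102 ≠ m300 := hne_of _ _ 0 (by simp [m102, m300])
  have ne_111_120 : m111 ≠ m120 := hne_of _ _ 1 (by simp [m111, m120])
  have ne_102_120 : m102 ≠ m120 := hne_of _ _ 1 (by simp [m102, m120])
  have ne_102_111 : m102 ≠ m111 := hne_of _ _ 1 (by simp [m102, m111])
  -- every coordinate is even in `x₀` or one of the four
  have hclass : ∀ p : DegIdx (Fin 3) 3,
      Even (p.1 0) ∨ p = m300 ∨ p = m120 ∨ p = m111 ∨ p = m102 := by
    intro p
    by_cases hp : Even (p.1 0)
    · exact Or.inl hp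
    rcases fin_three_degree_three_odd_cases p.1 (mem_degMonomials_iff.mp p.2) hp with h | h | h | h
    · exact Or.inr (Or.inl (Subtype.ext h))
    · exact Or.inr (Or.inr (Or.inl (Subtype.ext h)))
    · exact Or.inr (Or.inr (Or.inr (Or.inl (Subtype.ext h))))
    · exact Or.inr (Or.inr (Or.inr (Or.inr (Subtype.ext h))))
  have hodd_ne : ∀ p e : DegIdx (Fin 3) 3, ¬ Even (p.1 0) → Even (e.1 0) → e ≠ p := by
    rintro p e hp he rfl
    exact hp he
  -- the base cubic `q₀ = x₀²x₂ + x₁³`, the even coordinates `S`, the generic objects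
  let q₀ : MvPolynomial (Fin 3) ℂ :=
    monomial (Finsupp.single 0 2 + Finsupp.single 2 1) 1 + monomial (Finsupp.single 1 3) 1
  let S : Finset (DegIdx (Fin 3) 3) := Finset.univ.filter fun e => Even (e.1 0)
  have hS : ∀ e, e ∈ S ↔ Even (e.1 0) := fun e => by simp [S]
  let A : Matrix (Fin 3) (Fin 3) (MvPolynomial (DegIdx (Fin 3) 3) ℂ) :=
    Matrix.transvection 1 0 (X m111) * Matrix.transvection 2 0 (X m102) *
      Matrix.transvection 0 1 (X m120) * Matrix.transvection 0 2 (X m300)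
  let Q : MvPolynomial (Fin 3) (MvPolynomial (DegIdx (Fin 3) 3) ℂ) :=
    map (algebraMap ℂ (MvPolynomial (DegIdx (Fin 3) 3) ℂ)) q₀ + ∑ e ∈ S, monomial e.1 (X e)
  let Φ : DegIdx (Fin 3) 3 → MvPolynomial (DegIdx (Fin 3) 3) ℂ :=
    fun e => coeff e.1 (linSubst (Fin 3) (MvPolynomial (DegIdx (Fin 3) 3) ℂ) A Q)
  have hAdet : A.det = 1 := by
    simp only [A, Matrix.det_mul]
    rw [Matrix.det_transvection_of_ne (1 : Fin 3) 0 (by decide),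
      Matrix.det_transvection_of_ne (2 : Fin 3) 0 (by decide),
      Matrix.det_transvection_of_ne (0 : Fin 3) 1 (by decide),
      Matrix.det_transvection_of_ne (0 : Fin 3) 2 (by decide)]
    norm_num
  -- base change of `A` and `Q` along an algebra map `φ`
  have hAmap : ∀ {T : Type} [CommRing T] (φ : MvPolynomial (DegIdx (Fin 3) 3) ℂ →+* T),
      A.map φ = Matrix.transvection 1 0 (φ (X m111)) * Matrix.transvection 2 0 (φ (X m102)) *
        Matrix.transvection 0 1 (φ (X m120)) * Matrix.transvection 0 2 (φ (X m300)) := by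
    intro T _ φ
    simp only [A, Matrix.map_mul, transvection_map]
  have hQmap : ∀ {T : Type} [CommRing T] [Algebra ℂ T]
      (φ : MvPolynomial (DegIdx (Fin 3) 3) ℂ →ₐ[ℂ] T),
      map (φ : MvPolynomial (DegIdx (Fin 3) 3) ℂ →+* T) Q =
        map (algebraMap ℂ T) q₀ + ∑ e ∈ S, monomial e.1 (φ (X e)) := by
    intro T _ _ φ
    simp only [Q, map_add, map_map, AlgHom.comp_algebraMap, map_sum, map_monomial, RingHom.coe_coe]
  ------------------------------------------------------------------
  -- (i) `F` vanishes on the image of the parametrisation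
  ------------------------------------------------------------------
  have hvanish : ∀ x : DegIdx (Fin 3) 3 → ℂ, aeval (fun e => eval x (Φ e)) F = 0 := by
    intro x
    have hdet : (A.map ((aeval x : MvPolynomial (DegIdx (Fin 3) 3) ℂ →ₐ[ℂ] ℂ) : MvPolynomial (DegIdx (Fin 3) 3) ℂ →+* ℂ)).det = 1 := by
      rw [← RingHom.mapMatrix_apply, ← RingHom.map_det, hAdet, map_one]
    have hq : ∀ e ∈ (q₀ + ∑ e ∈ S, monomial e.1 (x e)).support, Even (e 0) := by
      intro e he
      by_contra hodd
      refine mem_support_iff.mp he ?_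
      have h1 : coeff e q₀ = 0 := by
        simp only [q₀, coeff_add, coeff_monomial]
        rw [if_neg, if_neg, add_zero]
        · rintro rfl
          exact hodd (by simp)
        · rintro rfl
          exact hodd (by simp)
      rw [coeff_add, h1, zero_add, coeff_sum]
      refine Finset.sum_eq_zero fun e' he' => ?_
      rw [coeff_monomial, if_neg]
      rintro rfl
      exact hodd ((hS e').mp he')
    have key := aeval_formCoeff_linSubst_eq_zero_of_odd hd hF ⟨_, hdet⟩ hq
    have hfun : (fun e => eval x (Φ e)) = formCoeff 3 (linSubst (Fin 3) ℂ
        (A.map ((aeval x : MvPolynomial (DegIdx (Fin 3) 3) ℂ →ₐ[ℂ] ℂ) :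
          MvPolynomial (DegIdx (Fin 3) 3) ℂ →+* ℂ)) (q₀ + ∑ e ∈ S, monomial e.1 (x e))) := by
      funext e
      change ((aeval x : MvPolynomial (DegIdx (Fin 3) 3) ℂ →ₐ[ℂ] ℂ) :
          MvPolynomial (DegIdx (Fin 3) 3) ℂ →+* ℂ)
          (coeff e.1 (linSubst (Fin 3) (MvPolynomial (DegIdx (Fin 3) 3) ℂ) A Q)) = _
      rw [← coeff_map, map_linSubst, hQmap, Algebra.algebraMap_self, map_id]
      simp only [aeval_X, formCoeff_apply]
    rw [hfun]
    exact key
  ------------------------------------------------------------------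
  -- (ii) the Jacobian matrix at the origin is diagonal with non-zero entries
  ------------------------------------------------------------------
  -- tangent vectors `ε e_p`
  let t : DegIdx (Fin 3) 3 → DegIdx (Fin 3) 3 → ℂ[ε] :=
    fun p i => if i = p then DualNumber.eps else 0
  have ht_self : ∀ p, t p p = DualNumber.eps := fun p => by simp [t]
  have ht_ne : ∀ {p i}, i ≠ p → t p i = 0 := fun h => by simp [t, h]
  -- the Jacobian entry `(e,p)` as an `ε`-component
  have hJ : ∀ p e : DegIdx (Fin 3) 3, eval (0 : DegIdx (Fin 3) 3 → ℂ) (pderiv p (Φ e)) =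
      TrivSqZeroExt.snd (coeff e.1 (linSubst (Fin 3) ℂ[ε]
        (A.map ((aeval (t p) : MvPolynomial (DegIdx (Fin 3) 3) ℂ →ₐ[ℂ] ℂ[ε]) : MvPolynomial (DegIdx (Fin 3) 3) ℂ →+* ℂ[ε]))
        (map (algebraMap ℂ ℂ[ε]) q₀ + ∑ e' ∈ S, monomial e'.1 (t p e')))) := by
    intro p e
    rw [← snd_aeval_dualNumber 0 p (t p) (fun i => by by_cases h : i = p <;> simp [t, h])
      (fun i => by by_cases h : i = p <;> simp [t, h]) (Φ e)]
    change TrivSqZeroExt.snd (((aeval (t p) : MvPolynomial (DegIdx (Fin 3) 3) ℂ →ₐ[ℂ] ℂ[ε]) : MvPolynomial (DegIdx (Fin 3) 3) ℂ →+* ℂ[ε])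
        (coeff e.1 (linSubst (Fin 3) (MvPolynomial (DegIdx (Fin 3) 3) ℂ) A Q))) = _
    rw [← coeff_map, map_linSubst, hQmap]
    simp only [aeval_X]
  -- the sum over `S` under `t p`: the monomial `p` itself if `p` is even, nothing if `p` is odd
  have hSum_even : ∀ p, Even (p.1 0) →
      ∑ e' ∈ S, monomial e'.1 (t p e') = (monomial p.1 DualNumber.eps : MvPolynomial (Fin 3) ℂ[ε]) := by
    intro p hp
    have h : ∀ e' ∈ S, monomial e'.1 (t p e') =
        (if e' = p then monomial p.1 DualNumber.eps else 0 : MvPolynomial (Fin 3) ℂ[ε]) := by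
      intro e' _
      by_cases h : e' = p
      · subst h; simp [t]
      · simp [t, h]
    rw [Finset.sum_congr rfl h, Finset.sum_ite_eq' S p, if_pos ((hS p).mpr hp)]
  have hSum_odd : ∀ p, ¬ Even (p.1 0) →
      ∑ e' ∈ S, monomial e'.1 (t p e') = (0 : MvPolynomial (Fin 3) ℂ[ε]) := by
    intro p hp
    refine Finset.sum_eq_zero fun e' he' => ?_
    rw [ht_ne (hodd_ne p e' hp ((hS e').mp he')), map_zero]
  -- odd columns: a common tail
  have hodd_col : ∀ (p : DegIdx (Fin 3) 3) (a b : Fin 3) (c : ℂ), c ≠ 0 → ¬ Even (p.1 0) →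
      A.map ((aeval (t p) : MvPolynomial (DegIdx (Fin 3) 3) ℂ →ₐ[ℂ] ℂ[ε]) : MvPolynomial (DegIdx (Fin 3) 3) ℂ →+* ℂ[ε]) =
        Matrix.transvection a b DualNumber.eps →
      X a * pderiv b q₀ = monomial p.1 c →
      ∃ c : ℂ, c ≠ 0 ∧ ∀ e : DegIdx (Fin 3) 3,
        eval (0 : DegIdx (Fin 3) 3 → ℂ) (pderiv p (Φ e)) = if e = p then c else 0 := by
    intro p a b c hc hp hA hlie
    refine ⟨c, hc, fun e => ?_⟩
    rw [hJ, hA, hSum_odd p hp, add_zero, linSubst_transvection_eps, snd_coeff_map_add_eps_mul, hlie,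
      coeff_monomial]
    by_cases he : e = p
    · subst he; simp
    · rw [if_neg he, if_neg]
      exact fun h => he (Subtype.ext h.symm)
  have hcol : ∀ p : DegIdx (Fin 3) 3, ∃ c : ℂ, c ≠ 0 ∧ ∀ e : DegIdx (Fin 3) 3,
      eval (0 : DegIdx (Fin 3) 3 → ℂ) (pderiv p (Φ e)) = if e = p then c else 0 := by
    intro p
    rcases hclass p with hp | rfl | rfl | rfl | rfl
    · -- even column: `A ↦ 1`, `Q ↦ q₀ + ε x^p`
      refine ⟨1, one_ne_zero, fun e => ?_⟩
      have hA : A.map ((aeval (t p) : MvPolynomial (DegIdx (Fin 3) 3) ℂ →ₐ[ℂ] ℂ[ε]) : MvPolynomial (DegIdx (Fin 3) 3) ℂ →+* ℂ[ε]) = 1 := by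
        rw [hAmap]
        simp only [RingHom.coe_coe, aeval_X, ht_ne (hodd_ne m111 p (by rw [h111]; decide) hp).symm,
          ht_ne (hodd_ne m102 p (by rw [h102]; decide) hp).symm,
          ht_ne (hodd_ne m120 p (by rw [h120]; decide) hp).symm,
          ht_ne (hodd_ne m300 p (by rw [h300]; decide) hp).symm, Matrix.transvection_zero, mul_one]
      rw [hJ, hA, hSum_even p hp, linSubst_one, AlgHom.id_apply, coeff_add, coeff_map, coeff_monomial,
        TrivSqZeroExt.snd_add, TrivSqZeroExt.algebraMap_eq_inl', TrivSqZeroExt.snd_inl, zero_add]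
      by_cases he : e = p
      · subst he; simp
      · rw [if_neg he, if_neg, TrivSqZeroExt.snd_zero]
        exact fun h => he (Subtype.ext h.symm)
    · -- `p = x₀³`: direction `x₂ ↦ x₂ + ε x₀`, polarisation `x₀ ∂₂ q₀ = x₀³`
      refine hodd_col m300 0 2 1 one_ne_zero (by rw [h300]; decide) ?_ X_zero_mul_pderiv_two_cusp
      rw [hAmap]
      simp only [RingHom.coe_coe, aeval_X, ht_self, ht_ne ne_111_300, ht_ne ne_102_300, ht_ne ne_120_300,
        Matrix.transvection_zero, one_mul]
    · -- `p = x₀x₁²`: direction `x₁ ↦ x₁ + ε x₀`, polarisation `x₀ ∂₁ q₀ = 3 x₀x₁²`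
      refine hodd_col m120 0 1 3 three_ne_zero (by rw [h120]; decide) ?_ X_zero_mul_pderiv_one_cusp
      rw [hAmap]
      simp only [RingHom.coe_coe, aeval_X, ht_self, ht_ne ne_111_120, ht_ne ne_102_120,
        ht_ne ne_120_300.symm, Matrix.transvection_zero, one_mul, mul_one]
    · -- `p = x₀x₁x₂`: direction `x₀ ↦ x₀ + ε x₁`, polarisation `x₁ ∂₀ q₀ = 2 x₀x₁x₂`
      refine hodd_col m111 1 0 2 two_ne_zero (by rw [h111]; decide) ?_ X_one_mul_pderiv_zero_cusp
      rw [hAmap]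
      simp only [RingHom.coe_coe, aeval_X, ht_self, ht_ne ne_102_111, ht_ne ne_111_120.symm,
        ht_ne ne_111_300.symm, Matrix.transvection_zero, mul_one]
    · -- `p = x₀x₂²`: direction `x₀ ↦ x₀ + ε x₂`, polarisation `x₂ ∂₀ q₀ = 2 x₀x₂²`
      refine hodd_col m102 2 0 2 two_ne_zero (by rw [h102]; decide) ?_ X_two_mul_pderiv_zero_cusp
      rw [hAmap]
      simp only [RingHom.coe_coe, aeval_X, ht_self, ht_ne ne_102_111.symm, ht_ne ne_102_120.symm,
        ht_ne ne_102_300.symm, Matrix.transvection_zero, mul_one, one_mul]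
  have hindep : AlgebraicIndependent ℂ Φ := by
    refine algebraicIndependent_of_det_jacobian_eval_ne_zero Φ 0 ?_
    choose c hc0 hc using hcol
    have hM : (Matrix.of fun e p => eval (0 : DegIdx (Fin 3) 3 → ℂ) (pderiv p (Φ e))) =
        Matrix.diagonal c := by
      ext e p
      rw [Matrix.of_apply, hc p e, Matrix.diagonal_apply]
      by_cases h : e = p
      · subst h; simp
      · simp [h]
    rw [hM, Matrix.det_diagonal]
    exact Finset.prod_ne_zero_iff.mpr fun p _ => hc0 p
  exact eq_zero_of_algebraicIndependent_of_forall_aeval_eval_eq_zero Φ hindep F hvanish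

/-- **`O(Sym³ℂ³)^{SL₃}_d = 0` for odd `d`.** [cite: BurgisserIkenmeyer2017, Ex. 3.7] -/
theorem slInvariantsOfDegree_three_three_eq_bot_of_odd {d : ℕ} (hd : Odd d) :
    slInvariantsOfDegree (Fin 3) ℂ 3 d = ⊥ :=
  (Submodule.eq_bot_iff _).mpr fun _ hF => eq_zero_of_mem_slInvariantsOfDegree_three_three_of_odd hd hF

/-- **`a_{(d,d,d)}(d[3]) = 0` for odd `d`**: the plethysm `Sym^d Sym³ ℂ³` contains no `SL₃`-invariant
when `d` is odd. [cite: BurgisserIkenmeyer2017, Ex. 3.7] -/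
theorem plethysmCoeff_three_three_const_eq_zero_of_odd {d : ℕ} (hd : Odd d) :
    plethysmCoeff ℂ (Fin 3) 3 (fun _ : Fin 3 => -(d : ℤ)) = 0 := by
  have h := finrank_slInvariantsOfDegree_eq_plethysmCoeff (m := 3) (D := 3) (d := d) (by norm_num)
    (by norm_num) ⟨d, by ring⟩
  rw [show (3 * d / 3 : ℕ) = d from Nat.mul_div_cancel_left d (by norm_num)] at h
  rw [← h, slInvariantsOfDegree_three_three_eq_bot_of_odd hd, finrank_bot]

/-- **BI 2017, Example 3.7, `E(3,3) = 2(ℕ ∖ {1})` — PROVED** (the degrees of the invariants of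
ternary cubics: `ℂ[S,T]`, `deg S = 4`, `deg T = 6`). [cite: BurgisserIkenmeyer2017, Ex. 3.7] -/
theorem genericDegreeMonoid_three_three :
    genericDegreeMonoid (Fin 3) ℂ 3 = {d | Even d ∧ d ≠ 2} :=
  genericDegreeMonoid_three_three_of_odd_vanishing fun _ hd =>
    plethysmCoeff_three_three_const_eq_zero_of_odd hd

/-- **BI 2017, Example 3.7 — DISCHARGED**: `E(2,2) = 2ℕ`, `E(3,3) = 2(ℕ ∖ {1})`, `e(3,3) = 4`,
`E(4,4) = ℕ ∖ {1,2,3,5,9}`, `e(4,4) = 4`. [cite: BurgisserIkenmeyer2017, Ex. 3.7] -/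
theorem BI2017_ex_3_7_holds : BI2017_ex_3_7 :=
  BI2017_ex_3_7_of_ternaryCubic_odd_vanishing fun _ hd =>
    plethysmCoeff_three_three_const_eq_zero_of_odd hd

end Main

end Literature.Computability.AlgebraicComplexity
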